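import Summits.ResolutionOfSingularities.ResolutionOfSingularities.Theorems.WeightedInvariantLocalWeightedDropTrackCStep
import Summits.ResolutionOfSingularities.ResolutionOfSingularities.Theorems.WeightedInvariantLocalWeightedDropTrackT4Defs
import Summits.ResolutionOfSingularities.ResolutionOfSingularities.Theorems.WeightedInvariantLocalWeightedDropTrackT4Frames
import Summits.ResolutionOfSingularities.ResolutionOfSingularities.Theorems.WeightedInvariantLocalWeightedDropTupleMonomial

/-!
# Track T4, the blow-up step: `TWonAt a (τ ≫ σ) → TWonAt a σ`

[OURS · L1 W4.3 · chain w43, Track T4 (tame double points at N = 4 modulo F-32bR), brick B3; stub worker 4] Engine crux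
`LocalWeightedDrop` (stmt-ResolutionOfSingularities-8899).  NOT a statement of any manuscript; the games are the programme's own.

`tWonAt_of_tWonAt_blowup`: for a blow-up `τ : Z'' ⟶ Z'` of an integral locally Noetherian `Z₀`-scheme along a non-zero centre `C`
with `V(C)` regular, `TWonAt a (τ ≫ σ) → TWonAt a σ` — the one-entry TUPLE-GAME version of Track C's `wonAt_of_wonAt_blowup`,
same scheme-theoretic skeleton (Matsumura 14.2 for the centre, adapted Cohen frames, the Refuter's point on the chart
`IsBlowup.exists_point_of_chart`, the formal square `exists_frame_square`).  Differences: the position is a non-zero BAD divisor `b`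
of the total transform of `a`; the Prover's move is `(φ, 𝟙_{l<n}, live slot)` with `φ` the change to the adapted frame (the tuple
game has coordinate changes built in); the Refuter's factorisation data `(D, G)` are taken as given (`TupleGame.IsTMove` shape), the
successor is `(s^{D mod 2} · G)|_{y_i = 0}` (`TupleMonomial.newTuple_fin_one`), and it divides the total transform upstairs because
`s^{D mod 2} ∣ s^D` (`SliceChart.subst_restrictedChart`).  Off the centre: `TrackC.exists_frame_transport`.
-/

noncomputable section

open CategoryTheory CategoryTheory.Limits AlgebraicGeometry TopologicalSpace IsLocalRing
open Literature.AlgebraicGeometry.Resolution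
open Literature.AlgebraicGeometry.Resolution.TupleGame
open Scheme.IdealSheafData

set_option linter.dupNamespace false -- mandated namespace of this single-conjunct summit

namespace Summit.ResolutionOfSingularities.ResolutionOfSingularities.Theorems.TrackT4

open TrackC TupleGame TupleMonomial

variable {k : Type} [Field k]

/-- The slice `y_i ↦ 0` fixes powers of the exceptional variable: `(s^r · G)| = s^r · G|`. [OURS · folklore] -/
theorem slice_X_pow_mul {m : ℕ} (i : Fin (m + 1)) (r : ℕ) (G : MvPowerSeries (Fin (m + 1 + 1)) k) :
    slice i (MvPowerSeries.X 0 ^ r * G) = MvPowerSeries.X 0 ^ r * slice i G := by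
  have hσ := CobordantChartPlaneSlice.hasSubst_slice (R := k) i
  unfold slice
  rw [← MvPowerSeries.coe_substAlgHom hσ, map_mul, map_pow, MvPowerSeries.substAlgHom_apply,
    MvPowerSeries.subst_X hσ]
  simp [(Fin.succ_ne_zero i).symm, Fin.predAbove_right_zero]

/-- **THE STEP OFF THE CENTRE.** [OURS · folklore] -/
theorem tWon_of_tWonAt_blowup_of_not_mem_support (a : MvPowerSeries (Fin 3) k)
    {Z' Z'' : Scheme.{0}} (σ : Z' ⟶ Spec (.of (MvPowerSeries (Fin 3) k))) (C : Z'.IdealSheafData)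
    (τ : Z'' ⟶ Z') (hτ : IsBlowup τ C) (h : TWonAt a (τ ≫ σ)) {z : Z'} (hz : z ∉ C.support)
    (hN : IsNoetherianRing (Z'.presheaf.stalk z)) (F : @Frame k _ Z' σ z hN) (b : MvPowerSeries (Fin 3) k)
    (hb : b ∣ F.e (algebraMap _ _ (totalGerm σ z a))) (hne : b ≠ 0) (hbad : Bad (fun _ : Fin (0 + 1) => b)) :
    TWon k 3 0 (fun _ : Fin (0 + 1) => b) := by
  obtain ⟨x', rfl⟩ := exists_preimage_of_not_mem_support hτ hz
  obtain ⟨hN'', F'', hF''⟩ := exists_frame_transport σ C τ hτ x' hz hN F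
  exact h x' hN'' F'' b (by rw [hF'']; exact hb) hne hbad

/-- **THE BLOW-UP STEP of Track T4.** For a blow-up `τ : Z'' ⟶ Z'` of an integral locally Noetherian `Z'`-scheme over
`Spec k⟦x₀,x₁,x₂⟧` along a non-zero centre `C` with `V(C)` regular: `TWonAt a (τ ≫ σ) → TWonAt a σ`. [OURS · folklore] -/
theorem tWonAt_of_tWonAt_blowup (a : MvPowerSeries (Fin 3) k)
    {Z' Z'' : Scheme.{0}} (σ : Z' ⟶ Spec (.of (MvPowerSeries (Fin 3) k))) [IsIntegral Z'] [IsLocallyNoetherian Z']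
    (C : Z'.IdealSheafData) (τ : Z'' ⟶ Z') (hτ : IsBlowup τ C) (hreg : Scheme.IsRegular C.subscheme) (hC : C ≠ ⊥)
    (h : TWonAt a (τ ≫ σ)) : TWonAt a σ := by
  classical
  intro z hN F b hb hne hbad
  by_cases hz : z ∈ C.support
  swap
  · exact tWon_of_tWonAt_blowup_of_not_mem_support a σ C τ hτ h hz hN F b hb hne hbad
  haveI := hN
  haveI := F.isRegularLocalRing
  haveI : IsDomain (MvPowerSeries (Fin 3) k) := NoZeroDivisors.to_isDomain _
  -- the centre at `z`: part of a regular system of parameters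
  have hCle : stalkIdeal C z ≤ maximalIdeal _ := (mem_support_iff_stalkIdeal_le C z).mp hz
  haveI := isRegularLocalRing_quotient_of_isRegular_subscheme C hreg hz
  obtain ⟨u, huspan, S, hCS⟩ := exists_rsop_of_isRegularLocalRing_quotient hCle
  have hd3 : (maximalIdeal (Z'.presheaf.stalk z)).spanFinrank = 3 := by
    have h1 := IsRegularLocalRing.spanFinrank_maximalIdeal (R := Z'.presheaf.stalk z)
    rw [F.ringKrullDim_eq] at h1
    exact_mod_cast h1
  obtain ⟨n, hn3, x, hxr, hxS, hn1⟩ := exists_prefix_reindex hd3 u S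
  have hxspan : Ideal.span (Set.range x) = maximalIdeal _ := by rw [hxr, huspan]
  have hCx : stalkIdeal C z = Ideal.span (Set.range fun l : Fin n => x (Fin.castLE hn3 l)) := by
    rw [hCS, hxS]
  replace hn1 : 1 ≤ n := by
    refine hn1 (Set.nonempty_iff_ne_empty.mpr fun hS => stalkIdeal_ne_bot_of_ne_bot hC z ?_)
    rw [hCS, hS, Set.image_empty, Ideal.span_empty]
  -- change of frame: `F'` adapted to `x`; the move's coordinate change is `φ`
  obtain ⟨F', hF'⟩ := F.exists_adapted x hxspan
  obtain ⟨φ, hφ0, hφdet, hφe⟩ := Frame.exists_subst F F'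
  have hφs : MvPowerSeries.HasSubst φ := MvPowerSeries.hasSubst_of_constantCoeff_zero hφ0
  have hb' : MvPowerSeries.subst φ b ∣ F'.e (algebraMap _ _ (totalGerm σ z a)) := by
    rw [hφe, ← MvPowerSeries.coe_substAlgHom hφs]
    exact map_dvd _ hb
  obtain ⟨M, hM⟩ := hb'
  -- THE MOVE: `(φ, 𝟙_{l<n}, live slot)`
  let w : Fin 3 → ℕ := fun l => if (l : ℕ) < n then 1 else 0
  let sel : (Fin 3 → k) → (Fin (0 + 1) → ℕ) → (Fin (0 + 1) → MvPowerSeries (Fin (3 + 1)) k) → Fin 3 :=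
    fun c _ _ => if hc : ∃ l, c l ≠ 0 then Classical.choose hc else 0
  have hsel : ∀ c : Fin 3 → k, c ≠ 0 → ∀ D G, c (sel c D G) ≠ 0 := by
    intro c hc D G
    have hex : ∃ l, c l ≠ 0 := by
      by_contra hcon
      push Not at hcon
      exact hc (funext hcon)
    simp only [sel, dif_pos hex]
    exact Classical.choose_spec hex
  have hb0 : (fun _ : Fin (0 + 1) => b) 0 ≠ 0 := hne
  have hw0 : 0 < w (Fin.castLE hn3 ⟨0, hn1⟩) := by
    have h : ((Fin.castLE hn3 ⟨0, hn1⟩ : Fin 3) : ℕ) < n := by simp; omega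
    simp only [w, h, if_true, Nat.one_pos]
  refine TWon.move φ w sel hφ0 hφdet (fun l => by simp only [w]; split_ifs <;> omega)
    ⟨Fin.castLE hn3 ⟨0, hn1⟩, hw0⟩ (fun c _ hc D G _ => hsel c hc D G)
    (fun cv hcw hc D G hDG hne' hbad' => ?_)
  -- the Refuter's data: exceptional point `cv`, factorisation `(D 0, G 0)`, live slot `i'`
  obtain ⟨hfac, hndvd⟩ := hDG 0 hb0
  set i' : Fin 3 := sel cv D G with hi'def
  have hci' : cv i' ≠ 0 := hsel cv hc D G
  have hi'n : ((i' : Fin 3) : ℕ) < n := by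
    by_contra hcn
    exact hci' (hcw i' (by simp only [w]; rw [if_neg hcn]))
  obtain ⟨iN, hiN⟩ : ∃ iN : Fin n, Fin.castLE hn3 iN = i' := ⟨⟨i', hi'n⟩, Fin.ext rfl⟩
  have hcv : ∀ l : Fin 3, n ≤ (l : ℕ) → cv l = 0 := fun l hl => hcw l (by simp only [w]; rw [if_neg (not_lt.mpr hl)])
  rw [← hiN] at hci'
  -- the successor: `(s^{D mod 2} · G)|_{y_i = 0}`
  rw [newTuple_fin_one _ hb0 D G i', sub_two_mul_div_two, slice_X_pow_mul, ← hiN] at hne' hbad' ⊢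
  -- the slice of `G 0`
  have hslice := SliceChart.subst_restrictedChart w cv hcw (MvPowerSeries.subst φ b) (D 0) (G 0) hfac (Fin.castLE hn3 iN)
  -- the Refuter's point: translated generators, chart ring map, prime, point
  obtain ⟨u', hu'⟩ : ∃ u' : Fin n → Z'.presheaf.stalk z, u' = fun l => if l = iN then x (Fin.castLE hn3 iN)
      else x (Fin.castLE hn3 l) - stalkConst σ z (cv (Fin.castLE hn3 l) / cv (Fin.castLE hn3 iN)) *
        x (Fin.castLE hn3 iN) := ⟨_, rfl⟩
  have hu'i : u' iN = x (Fin.castLE hn3 iN) := by rw [hu']; simp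
  have hu'l : ∀ l, l ≠ iN → u' l = x (Fin.castLE hn3 l) -
      stalkConst σ z (cv (Fin.castLE hn3 l) / cv (Fin.castLE hn3 iN)) * x (Fin.castLE hn3 iN) := by
    intro l hl; rw [hu']; simp [hl]
  have hu'span : Ideal.span (Set.range u') = stalkIdeal C z := by
    rw [hCx]; exact span_translated_eq hn3 x iN _ u' hu'i hu'l
  obtain ⟨χ, hχb, hχe, hχm⟩ := exists_chartHom F' x hF' hn3 cv iN hci' hcv u' hu'i hu'l
  let w𝔴 : Spec (.of (chartRing u' iN)) := ⟨Ideal.comap χ (maximalIdeal _), Ideal.IsPrime.comap _⟩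
  have hw : w𝔴.asIdeal.comap (chartBase u' iN) = maximalIdeal _ := by
    change (Ideal.comap χ _).comap _ = _
    rw [Ideal.comap_comap]; exact hχm
  obtain ⟨x', q, hx'z, hqw, hiso, hsq⟩ := IsBlowup.exists_point_of_chart hτ z u' hu'span iN w𝔴 hw
  subst hx'z
  -- the Cohen frame at `x'` and the formal square
  have hnm : n + (3 - n) = 3 := by omega
  obtain ⟨wv, hwv'⟩ : ∃ wv : Fin (3 - n) → Z'.presheaf.stalk (τ x'),
      wv = fun j : Fin (3 - n) => x ⟨n + (j : ℕ), by have := j.2; omega⟩ := ⟨_, rfl⟩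
  have hwv : ∀ j : Fin (3 - n), wv j = x ⟨n + (j : ℕ), by have := j.2; omega⟩ := fun j => by rw [hwv']
  have hz : Ideal.span (Set.range (Fin.append u' wv)) = maximalIdeal _ := by
    rw [range_fin_append, Ideal.span_union, hu'span, hCx, ← Ideal.span_union, ← hxspan,
      range_eq_union_prefix hnm x, hwv']
  obtain ⟨hN'', F'', hsqr⟩ := exists_frame_square σ C τ hτ x' F' x hF' hnm cv iN hci' hcv u' hu'i hu'l wv hwv hz
    χ hχb hχe w𝔴 rfl q hqw hiso hsq
  -- the successor divides the total transform in the frame `F''`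
  refine h x' hN'' F'' _ ?_ (fun h0 => hne' (funext fun _ => h0)) hbad'
  have hρs : MvPowerSeries.HasSubst (fun l : Fin 3 => (MvPowerSeries.X 0 : MvPowerSeries (Fin 3) k) ^
      (if (l : ℕ) < n then 1 else 0) * (MvPowerSeries.C (cv l) + if l = Fin.castLE hn3 iN then
        (0 : MvPowerSeries (Fin 3) k) else MvPowerSeries.X (Fin.predAbove (Fin.castLE hn3 iN) l.succ))) :=
    MvPowerSeries.hasSubst_of_constantCoeff_zero (constantCoeff_rchart cv _ n hcv)
  have hT'' : F''.e (algebraMap _ _ (totalGerm (τ ≫ σ) x' a)) =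
      MvPowerSeries.subst (fun l : Fin 3 => (MvPowerSeries.X 0 : MvPowerSeries (Fin 3) k) ^
        (if (l : ℕ) < n then 1 else 0) * (MvPowerSeries.C (cv l) + if l = Fin.castLE hn3 iN then
          (0 : MvPowerSeries (Fin 3) k) else MvPowerSeries.X (Fin.predAbove (Fin.castLE hn3 iN) l.succ)))
        (F'.e (algebraMap _ _ (totalGerm σ (τ x') a))) := by
    have hof : ∀ b : Z'.presheaf.stalk (τ x'), DeJong1996.completedStalkMap τ x' (algebraMap _ _ b) =
        algebraMap (Z''.presheaf.stalk x') _ ((τ.stalkMap x').hom b) := fun b => DeJong1996.completedStalkMap_of τ x' b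
    rw [totalGerm_comp, ← hof]
    exact hsqr _
  have hslice' : MvPowerSeries.subst (fun l : Fin 3 => (MvPowerSeries.X 0 : MvPowerSeries (Fin 3) k) ^
      (if (l : ℕ) < n then 1 else 0) * (MvPowerSeries.C (cv l) + if l = Fin.castLE hn3 iN then
        (0 : MvPowerSeries (Fin 3) k) else MvPowerSeries.X (Fin.predAbove (Fin.castLE hn3 iN) l.succ)))
      (MvPowerSeries.subst φ b) = MvPowerSeries.X 0 ^ D 0 * slice (Fin.castLE hn3 iN) (G 0) := hslice
  rw [hT'', hM, MvPowerSeries.subst_mul hρs, hslice']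
  exact Dvd.dvd.mul_right (mul_dvd_mul (pow_dvd_pow _ (Nat.mod_le _ _)) dvd_rfl) _

end Summit.ResolutionOfSingularities.ResolutionOfSingularities.Theorems.TrackT4

end
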